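import Literature.Geometry.Riemannian.RicciFlowMaximal
import Literature.Geometry.Riemannian.CanonicalNeighbourhoods
import Literature.Geometry.Riemannian.HamiltonPCOClassification
import HarnessLib

/-!
# Ricci flow with surgery on PIC 4-manifolds: the structure of Chen–Zhu's Theorem 1.1
(topic `Geometry/Riemannian`)

Layer RF6 (top of the analytic debt) of the decomposition of `Literature.Geometry.Riemannian.hamilton_chen_tang_zhu`
(`HamiltonPICProofs.lean`). Chen–Zhu (J. Differential Geom. 74 (2006), arXiv:math/0504478),
Thm. 1.1 (p. 3), describes the outcome of the Ricci flow with surgery on a compact 4-manifold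
with positive isotropic curvature and no essential incompressible space form *structurally*:
a finite sequence of smooth solutions `g^{(k)}(t)` on compact manifolds `M_k × [t_k, t_{k+1})`,
`M_0 = M`, `g^{(0)}(0) = g`, going singular as `t → t_{k+1}`, with (i) open `Ω_k ⊆ M_k` over
which `g^{(k)}(t)` extends smoothly to `t = t_{k+1}`, (ii) compact 4-dimensional submanifolds
with smooth boundary `N_k` of `(Ω_k, g^{(k)}(t_{k+1}))` and of `(M_{k+1}, g^{(k+1)}(t_{k+1}))`
which are isometric, (iii) "`M_k ∖ N_k` consists of a finite number of disjoint pieces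
diffeomorphic to `S³ × 𝕀`, `𝔹⁴` or `ℝℙ⁴ ∖ 𝔹⁴`, while `M_{k+1} ∖ N_k` consists of a finite number
of disjoint pieces diffeomorphic to `𝔹⁴`", and (iv) `M_m` diffeomorphic to a finite disjoint
union of `S⁴`, `ℝℙ⁴`, `S³ × S¹`, `S³ ×~ S¹`, `ℝℙ⁴ # ℝℙ⁴`. None of this mentions `δ`-necks,
canonical neighbourhoods or the surgery procedure itself (those enter its *proof*, §5), so the
statement is vendable now, over the Ricci-flow layer (`RicciFlow.lean`, `RicciFlowMaximal.lean`)
and the topology of the tree (`IsHamiltonPICPiece`, `Literature.Topology.FourManifolds.IsConnectedSumOf`,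
`openBall`/`puncturedRealProjectiveSpace`). This file gives that structure a name
(`ChenZhuResolvableIn m M g₀`, "`(M, g₀)` is resolved by a Ricci flow with `m` surgeries", by
recursion on `m`, each stage time-shifted to start at `0` — the flow is autonomous,
`IsRicciFlow.comp_add_const`); Thm. 1.1 for simply connected `M` is then the statement
`∀ M g₀, g₀ Riemannian of positive isotropic curvature → ∃ m, ChenZhuResolvableIn m M g₀`.
**That statement is not a named fact of the tree.** It was first vended here as the named fact
`chenZhu_ricciFlowWithSurgery`, a decomposition child of `hamilton_chen_tang_zhu` (Hamilton's
Cor. 1.2(a)); the review of that decomposition (2026-08-15, D-0026/D-0027) found the child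
equivalent to its parent modulo short-time existence of the Ricci flow and Cerf's theorem — with
`m = 0` surgeries, clause (iv) `IsUnionOfPieces` being a property of the manifold alone
(`chenZhuResolvable_iff_hamilton_chen_tang_zhu`, `ChenZhuStructureFromClassification.lean`) — hence
a restatement carrying no proof burden of its own, and merged it back into `hamilton_chen_tang_zhu`.
The deduction of Hamilton's classification (`hamilton_pic_classification_four`, hence
`hamilton_chen_tang_zhu`) from the statement is pure differential topology (inverse surgery =
connected sum; `π₁`-bookkeeping; Cerf's `Γ₄ = 0`) and is PROVED in the tree with the statement as
an explicit hypothesis (`SurgicalRicciFlowBridge.lean`, `HamiltonPICHolds.lean`); the analytic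
path to the statement is `chenZhu_ricciFlowWithSurgery_of_step` (`SurgicalSolutionsCount.lean`:
Chen–Zhu's Thm. 5.6 from the base of their induction and the surgery step of §5, then Thm. 1.1).

## Renderings and one correction of the printed (iii)

* "go singular as `t → t_{k+1}`": `IsMaximalRicciFlow` (finite-time maximal flow of Riemannian
  metrics; curvature blow-up is then the fact `ricciFlow_curvature_blowup`).
* (i)+(ii): we only retain what (ii)–(iv) use of `Ω_k`: an open `U ⊇ N_k` and a Riemannian
  metric `ḡ` on `M_k` such that `t ↦ g^{(k)}(t)` (`t < T`) extended by `ḡ` at `t = T` is jointly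
  `C^∞` on `U × [0, T]` (`ExtendsSmoothlyTo`; weaker than (i), which has `U = Ω_k` and `ḡ` the
  limit on all of `Ω_k` — a cut-off `χ ḡ + (1-χ) g(0)` of the latter is a global Riemannian
  metric agreeing with it near `N_k`).
* "compact four-dimensional submanifold with smooth boundary": a compact *regular domain*,
  i.e. a regular sublevel set `{f ≤ 0}` of a smooth `f` with `0` a regular value (Lee 2012,
  Prop. 5.47 (a) and Thm. 5.48: regular domains are exactly the regular sublevel sets)
  (`IsCompactRegularDomain`).
* "isometric": a diffeomorphism between open neighbourhoods of `N_k ⊆ M_k` and `N_k' ⊆ M_{k+1}`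
  carrying `N_k` onto `N_k'` and pulling `g^{(k+1)}(0)` back to `ḡ` at the points of `N_k`
  (`AreIsometricDomains`; an isometry of compact Riemannian manifolds with boundary extends to a
  diffeomorphism of collar neighbourhoods, so this is the printed notion).
* (iii), pieces, **collared reading**: the connected components of the open set `M_k ∖ N_k` are
  finitely many and each is the interior of an embedded compact model attached to `N_k` along
  boundary spheres with collars: the middle third of an embedded open tube `S³ × ℝ` whose outer
  thirds lie in `N_k` (`IsNeckPiece`), the unit ball of an embedded `ℝ⁴` whose rest lies in `N_k`
  (`IsBallPiece`), or the corresponding collared `ℝℙ⁴ ∖ 𝔹̄⁴` (`IsProjectiveCapPiece`), **or a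
  closed component of `M_k` lying in the class of Thm. 1.1 (iv)** (`IsDiscardedPiece`: an
  iterated connected sum of Hamilton's pieces `S⁴`, `ℝℙ⁴`, `S³ × S¹`, `S³ ×~ S¹`). The collars
  are how the pieces of the construction arise (tubes are `ε`-tubes cut at middle spheres of
  `δ`-necks straddling `∂N_k`, caps are surgery caps / `ε`-caps glued or attached along necks:
  §5, p. 29; §4, p. 24) and are what makes "a connected sum" in Cor. 1.2 a *direct* consequence
  (p. 3: "As a direct consequence we have the following classification result") — the bare
  diffeomorphism types of the open pieces would leave a 4-dimensional Schoenflies problem at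
  each attaching sphere (cf. Hamilton 1997, App. 7, "replacement for Schoenflies", p. 88).
  The last alternative (discarded components) is NOT in the printed (iii) but is forced by the
  construction the theorem summarises: at each surgery time Chen–Zhu "throw away all the compact
  components lying in `Ω ∖ Ω_σ` or with positive curvature operator", each "diffeomorphic to
  `S⁴`, or `ℝℙ⁴`, or `S³ × S¹`, or `S³ ×~ S¹`" (§5, p. 27; procedures (2)–(4), pp. 29–30), and the
  components on which the solution becomes extinct are "diffeomorphic to the union of a finite
  number of `S⁴`, or `ℝℙ⁴`, or `S³ × S¹`, or `S³ ×~ S¹`, or a connected sum of them" (p. 27); such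
  a component (e.g. a round `S⁴` factor disappearing at `t_{k+1}` while the rest is operated on)
  lies in `M_k ∖ N_k` and is not "`S³ × 𝕀`, `𝔹⁴` or `ℝℙ⁴ ∖ 𝔹⁴`". With the printed (iii) read
  literally the theorem would be false for the flow constructed in §5; we vend the corrected
  reading and flag it here. The components of `M_{k+1} ∖ N_k'` are finitely many collared balls
  ("pieces diffeomorphic to `𝔹⁴`": the surgery caps).
* (iv): every component of `M_m` is an iterated connected sum of Hamilton's pieces
  (`Literature.IsConnectedSumOf 4 IsHamiltonPICPiece`; the printed list "`S⁴`, `ℝℙ⁴`, `S³ × S¹`,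
  `S³ ×~ S¹`, `ℝℙ⁴ # ℝℙ⁴`" consists of such, so this is weaker than printed, as befits a conclusion).
* Hypothesis: `M : Type` closed (compact, Hausdorff, second countable, `C^∞`, on `ℝ⁴`) and
  **simply connected**, the case in which "no essential incompressible space form" is vacuous
  (`π₁ = 1`; Chen–Tang–Zhu 2012, p. 3) and the one `hamilton_chen_tang_zhu` needs; initial metric
  `C^∞`, Riemannian, of positive isotropic curvature (`HasPositiveIsotropicCurvature`).

## Main definitions and the fact

* `IsCompactRegularDomain I N`, `componentsOf U`, `IsContMDiffFamilyOnSet`, `ExtendsSmoothlyTo`,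
  `AreIsometricDomains`, `polarCapOf`, `IsNeckPiece N C`/`IsBallPiece N C`/`IsProjectiveCapPiece N C`
  (collared pieces)/`IsDiscardedPiece`, `PresurgeryPieces N`, `PostsurgeryPieces N'`,
  `IsUnionOfPieces M`, `IsSurgeryStep g T g₀'`, `ChenZhuResolvableIn m M g₀`.
* No named fact: Thm. 1.1 (simply connected case) is the statement displayed above, consumed as
  a hypothesis downstream.
* Proved: unfolding lemmas, `ChenZhuResolvableIn.exists_isMaximalRicciFlow`, reflexivity of
  `AreIsometricDomains`, the closed unit ball is a compact regular domain, the model ball and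
  projective cap pieces, and the trivial surgery step `isSurgeryStep_self` (consistency of the
  relation).

## References

* B.-L. Chen, X.-P. Zhu, *Ricci flow with surgery on four-manifolds with positive isotropic
  curvature*, J. Differential Geom. 74 (2006) 177–264, arXiv:math/0504478: Thm. 1.1 (p. 3),
  Def. 5.1 (p. 26), §5 pp. 27, 29–30. [ChenZhu2006]
* R. S. Hamilton, *Four-manifolds with positive isotropic curvature*, Comm. Anal. Geom. 5 (1997),
  Thm. 1.1 (p. 2), §E. [Hamilton1997]
* J. M. Lee, *Introduction to Smooth Manifolds*, 2nd ed. (2012), Ch. 5, Prop. 5.46, 5.47,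
  Thm. 5.48 (regular domains). [Lee2012]
-/

noncomputable section

open Bundle Set Function TopologicalSpace
open scoped Manifold ContDiff Topology

namespace Literature.Geometry.Riemannian

open Lorentzian

/-- Local notation: `𝔼 n` is the model Euclidean space `EuclideanSpace ℝ (Fin n)`. -/
local notation "𝔼 " n:arg => EuclideanSpace ℝ (Fin n)

/-- Local notation: `𝕊 n` is the unit sphere in `EuclideanSpace ℝ (Fin (n + 1))`. -/
local notation "𝕊 " n:arg => (Metric.sphere (0 : EuclideanSpace ℝ (Fin (n + 1))) 1)

/-- Local notation: smooth pseudo-Riemannian metrics on the tangent bundle of a 4-manifold `M`. -/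
local notation "Metric₄ " M:arg =>
  PseudoRiemannianMetric (𝓡 4) ∞ (EuclideanSpace ℝ (Fin 4)) (TangentSpace (𝓡 4) : M → Type _)

/-- Local notation: covariant derivatives on the tangent bundle of a 4-manifold `M`. -/
local notation "Connection₄ " M:arg =>
  CovariantDerivative (𝓡 4) (EuclideanSpace ℝ (Fin 4)) (TangentSpace (𝓡 4) : M → Type _)

/-! ### Regular domains, components, local smooth families, isometric domains -/

section General

variable {E : Type*} [NormedAddCommGroup E] [NormedSpace ℝ E] {H : Type*} [TopologicalSpace H]
  {I : ModelWithCorners ℝ E H} {M : Type*} [TopologicalSpace M] [ChartedSpace H M]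
  {E' : Type*} [NormedAddCommGroup E'] [NormedSpace ℝ E'] {H' : Type*} [TopologicalSpace H']
  {I' : ModelWithCorners ℝ E' H'} {M' : Type*} [TopologicalSpace M'] [ChartedSpace H' M']

variable (I) in
/-- **`N` is a compact regular domain** in `M` ("compact four-dimensional submanifold with
smooth boundary", Chen–Zhu 2006, Thm. 1.1 (ii)): `N` is compact and is a *regular sublevel set*
`{f ≤ 0}` of a smooth function `f : M → ℝ` for which `0` is a regular value — by Lee 2012,
Prop. 5.47 (a) ("for each regular value `b` of `f`, the sublevel set `f⁻¹((-∞, b])` is a regular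
domain") and Thm. 5.48 ("if `D ⊆ M` is a regular domain, then there exists a defining function
for `D`") exactly the compact regular domains, i.e. compact properly embedded codimension-0
submanifolds with boundary. [cite: Lee2012, Ch. 5, Prop. 5.47 (a) and Thm. 5.48] -/
def IsCompactRegularDomain (N : Set M) : Prop :=
  IsCompact N ∧ ∃ f : M → ℝ, ContMDiff I 𝓘(ℝ, ℝ) ∞ f ∧ N = {x | f x ≤ 0} ∧
    ∀ x, f x = 0 → mfderiv I 𝓘(ℝ, ℝ) f x ≠ 0

/-- A compact regular domain is compact. [folklore] -/
theorem IsCompactRegularDomain.isCompact {N : Set M} (h : IsCompactRegularDomain I N) :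
    IsCompact N := h.1

/-- A compact regular domain is closed (a sublevel set of a continuous function). [folklore] -/
theorem IsCompactRegularDomain.isClosed {N : Set M} (h : IsCompactRegularDomain I N) :
    IsClosed N := by
  obtain ⟨-, f, hf, rfl, -⟩ := h
  exact isClosed_le hf.continuous continuous_const

/-- **The connected components of a subset `U ⊆ M`**, as a set of subsets
(`connectedComponentIn U x`, `x ∈ U`). [folklore] -/
def componentsOf (U : Set M) : Set (Set M) :=
  (fun x ↦ connectedComponentIn U x) '' U

omit [ChartedSpace H M] in
/-- Every point of `U` lies in its component, which is one of the components of `U`. [folklore] -/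
theorem connectedComponentIn_mem_componentsOf {U : Set M} {x : M} (hx : x ∈ U) :
    connectedComponentIn U x ∈ componentsOf U := ⟨x, hx, rfl⟩

variable [IsManifold I ∞ M] [IsManifold I' ∞ M']

/-- **Joint smoothness of a family of metrics on `U × S`**: the map `(x, t) ↦ g_t(x)` into the
bundle of bilinear forms on `TM` is `C^k` on `U ×ˢ S` — the localisation to an open `U ⊆ M` of
`IsContMDiffFamilyOn` (`RicciFlow.lean`, the case `U = univ`). [folklore] -/
def IsContMDiffFamilyOnSet (k : ℕ∞ω) {n : ℕ∞ω}
    (g : ℝ → PseudoRiemannianMetric I n E (TangentSpace I : M → Type _)) (U : Set M) (S : Set ℝ) :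
    Prop :=
  ContMDiffOn (I.prod 𝓘(ℝ, ℝ)) (I.prod 𝓘(ℝ, E →L[ℝ] E →L[ℝ] ℝ)) k
    (fun p : M × ℝ ↦ TotalSpace.mk' (E →L[ℝ] E →L[ℝ] ℝ) (E := fun b : M ↦
      TangentSpace I b →L[ℝ] TangentSpace I b →L[ℝ] ℝ) p.1 ((g p.2).val p.1))
    (U ×ˢ S)

/-- On `U = M` the local notion is `IsContMDiffFamilyOn`. [folklore] -/
theorem isContMDiffFamilyOnSet_univ_iff {k n : ℕ∞ω}
    {g : ℝ → PseudoRiemannianMetric I n E (TangentSpace I : M → Type _)} {S : Set ℝ} :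
    IsContMDiffFamilyOnSet k g univ S ↔ IsContMDiffFamilyOn k g S := Iff.rfl

/-- Monotonicity of local joint smoothness in the set and the time set. [folklore] -/
theorem IsContMDiffFamilyOnSet.mono {k n : ℕ∞ω}
    {g : ℝ → PseudoRiemannianMetric I n E (TangentSpace I : M → Type _)} {U U' : Set M}
    {S S' : Set ℝ} (h : IsContMDiffFamilyOnSet k g U S) (hU : U' ⊆ U) (hS : S' ⊆ S) :
    IsContMDiffFamilyOnSet k g U' S' :=
  ContMDiffOn.mono h (prod_mono hU hS)

/-- **The flow `g` on `[0, T)` extends smoothly to `t = T` by `ḡ` over `U`** (Chen–Zhu 2006,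
Thm. 1.1 (i): "the solution `g^{(k)}(t)` can be smoothly extended to `t = t_{k+1}` over `Ω_k`",
localised to `U`): the family `t ↦ g t` for `t < T`, `ḡ` for `t ≥ T`, is jointly `C^∞` on
`U × [0, T]`. [cite: ChenZhu2006, Thm. 1.1 (i) (p. 3)] -/
def ExtendsSmoothlyTo (g : ℝ → PseudoRiemannianMetric I ∞ E (TangentSpace I : M → Type _))
    (T : ℝ) (gbar : PseudoRiemannianMetric I ∞ E (TangentSpace I : M → Type _)) (U : Set M) :
    Prop :=
  IsContMDiffFamilyOnSet ∞ (fun t ↦ if t < T then g t else gbar) U (Icc 0 T)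

/-- **`(M, ḡ) ⊇ N` and `(M', g') ⊇ N'` are isometric domains** (Chen–Zhu 2006, Thm. 1.1 (ii):
"`(Ω_k, ḡ)` and `(M_{k+1}, g^{(k+1)}(t_{k+1}))` contain compact … submanifolds with smooth
boundary, which are isometric and then can be denoted by `N_k`"; Def. 5.1: "by identifying
these isometric submanifolds"): there are open `U ⊇ N`, `U' ⊇ N'` and mutually inverse `C^∞`
maps `Φ : U → U'`, `Ψ : U' → U` (given as maps `M → M'`, `M' → M`, smooth on `U`, `U'`) with
`Φ(N) = N'` and `Φ^* g' = ḡ` at the points of `N` — an isometry of the compact Riemannian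
manifolds with boundary `(N, ḡ) ≅ (N', g')` extended to a diffeomorphism of open (collar)
neighbourhoods. [cite: ChenZhu2006, Thm. 1.1 (ii) (p. 3) and Def. 5.1 (p. 26)] -/
def AreIsometricDomains (gbar : PseudoRiemannianMetric I ∞ E (TangentSpace I : M → Type _))
    (g' : PseudoRiemannianMetric I' ∞ E' (TangentSpace I' : M' → Type _)) (N : Set M)
    (N' : Set M') : Prop :=
  ∃ (U : Set M) (U' : Set M') (Φ : M → M') (Ψ : M' → M),
    IsOpen U ∧ N ⊆ U ∧ IsOpen U' ∧ N' ⊆ U' ∧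
    ContMDiffOn I I' ∞ Φ U ∧ ContMDiffOn I' I ∞ Ψ U' ∧ MapsTo Φ U U' ∧ MapsTo Ψ U' U ∧
    (∀ x ∈ U, Ψ (Φ x) = x) ∧ (∀ y ∈ U', Φ (Ψ y) = y) ∧ Φ '' N = N' ∧
    ∀ x ∈ N, ∀ v w : TangentSpace I x,
      g'.val (Φ x) (mfderiv I I' Φ x v) (mfderiv I I' Φ x w) = gbar.val x v w

omit [IsManifold I' ∞ M'] in
/-- **Reflexivity**: `(M, g) ⊇ N` is isometric to itself (`Φ = Ψ = id`, `U = U' = M`).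
[folklore] -/
theorem areIsometricDomains_refl (g : PseudoRiemannianMetric I ∞ E (TangentSpace I : M → Type _))
    (N : Set M) : AreIsometricDomains g g N N := by
  refine ⟨univ, univ, id, id, isOpen_univ, subset_univ _, isOpen_univ, subset_univ _,
    contMDiff_id.contMDiffOn, contMDiff_id.contMDiffOn, mapsTo_univ _ _, mapsTo_univ _ _,
    fun _ _ ↦ rfl, fun _ _ ↦ rfl, image_id _, fun x _ v w ↦ ?_⟩
  rw [mfderiv_id]
  rfl

end General

/-! ### A model regular domain: the closed unit ball -/

section Ball

/-- **The closed unit ball of `ℝⁿ` is a compact regular domain**: `{|x|² - 1 ≤ 0}` with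
`d(|x|² - 1) = 2⟨x, ·⟩ ≠ 0` on the unit sphere (Lee 2012, p. 120: "the closed unit ball
`𝔹̄ⁿ ⊆ ℝⁿ`" as an example of a regular domain). [cite: Lee2012, Ch. 5, p. 120 and Prop. 5.47 (a)] -/
theorem isCompactRegularDomain_closedBall (n : ℕ) :
    IsCompactRegularDomain 𝓘(ℝ, 𝔼 n) (Metric.closedBall (0 : 𝔼 n) 1) := by
  refine ⟨isCompact_closedBall 0 1, fun x ↦ ‖x‖ ^ 2 - 1, ?_, ?_, ?_⟩
  · rw [contMDiff_iff_contDiff]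
    exact (contDiff_norm_sq ℝ).sub contDiff_const
  · ext x
    simp only [Metric.mem_closedBall, dist_zero_right, mem_setOf_eq, sub_nonpos]
    constructor
    · intro h; nlinarith [norm_nonneg x]
    · intro h; nlinarith [norm_nonneg x]
  · intro x hx h0
    have hx1 : ‖x‖ ^ 2 = 1 := by linarith
    have key : fderiv ℝ (fun y : 𝔼 n ↦ ‖y‖ ^ 2 - 1) x x = 2 * ‖x‖ ^ 2 := by
      rw [fderiv_sub_const, fderiv_norm_sq_apply]
      simp [innerSL_apply_apply, two_mul]
    have h0' : fderiv ℝ (fun y : 𝔼 n ↦ ‖y‖ ^ 2 - 1) x = 0 := by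
      have h1 := h0
      rwa [mfderiv_eq_fderiv] at h1
    rw [h0', zero_apply, hx1] at key
    norm_num at key

end Ball

/-! ### The pieces (Chen–Zhu 2006, Thm. 1.1 (iii)–(iv)), with their collars -/

section Pieces

variable {M : Type} [TopologicalSpace M] [ChartedSpace (𝔼 4) M]

/-- The closed polar cap `{y ∈ Sⁿ | y₀ ≥ a}` of the unit sphere (`polarCap n` is the case
`a = 1/2`); for `0 < a < 1` its image in `ℝℙⁿ` is an embedded closed ball. [folklore] -/
def polarCapOf (n : ℕ) (a : ℝ) : Set (𝕊 n) :=
  {y | a ≤ (y : 𝔼 (n + 1)) 0}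

/-- `polarCap` is the polar cap of height `1/2`. [folklore] -/
theorem polarCapOf_half (n : ℕ) : polarCapOf n (1 / 2) = polarCap n := rfl

/-- **`C` is a (collared) neck piece relative to `N`**: `C` is the middle third `ι(S³ × (0, 1))`
of a smoothly embedded open tube `ι : S³ × ℝ ↪ M⁴` whose two remaining ends `ι(S³ × (ℝ ∖ (0,1)))`
lie in `N` — the piece "diffeomorphic to `S³ × 𝕀`" of Chen–Zhu 2006, Thm. 1.1 (iii) together
with the way it is attached: its closure is an embedded `S³ × [0, 1]` meeting `N` in the two
boundary spheres, with product collars on both sides (in §5 the tubes are `ε`-tubes cut along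
middle spheres of `δ`-necks, which straddle `∂N_k`: p. 29). [cite: ChenZhu2006, Thm. 1.1 (iii) (p. 3) and §5, p. 29] -/
def IsNeckPiece (N C : Set M) : Prop :=
  ∃ ι : (𝕊 3) × ℝ → M, Manifold.IsSmoothEmbedding ((𝓡 3).prod 𝓘(ℝ, ℝ)) (𝓡 4) ∞ ι ∧
    IsOpen (range ι) ∧ ι '' (univ ×ˢ Ioo 0 1) = C ∧ ι '' (univ ×ˢ (Ioo 0 1)ᶜ) ⊆ N

/-- **`C` is a (collared) ball piece relative to `N`**: `C` is the unit ball `ι(𝔹⁴)` of a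
smoothly embedded `ι : ℝ⁴ ↪ M⁴` (open image) mapping the rest of `ℝ⁴` into `N` — the piece
"diffeomorphic to `𝔹⁴`" of Thm. 1.1 (iii) with its attachment: its closure is a smoothly
embedded closed 4-disc meeting `N` in its boundary sphere, collared on both sides (in §5: the
surgery caps `(𝔹⁴, g̃)` glued in along `δ`-necks, p. 29, and the `ε`-caps of type `𝔹⁴`).
[cite: ChenZhu2006, Thm. 1.1 (iii) (p. 3) and §5, p. 29] -/
def IsBallPiece (N C : Set M) : Prop :=
  ∃ ι : 𝔼 4 → M, Manifold.IsSmoothEmbedding (𝓡 4) (𝓡 4) ∞ ι ∧ IsOpen (range ι) ∧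
    ι '' Metric.ball 0 1 = C ∧ ι '' (Metric.ball 0 1)ᶜ ⊆ N

/-- **`C` is a (collared) projective cap piece relative to `N`**: `C` is the image
`ι(ℝℙ⁴ ∖ B̄)` , `B̄` the image of the closed polar cap of height `1/4`, under a smooth embedding
(open image) `ι` of the larger `ℝℙ⁴ ∖ 𝔹̄⁴ = puncturedRealProjectiveSpace 4` (the cap of height
`1/2` removed) which maps the annulus between the two caps into `N` — the piece "diffeomorphic to
`ℝℙ⁴ ∖ 𝔹⁴`" of Thm. 1.1 (iii) with its attachment along a neck (the `ε`-caps of type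
`ℝℙ⁴ ∖ 𝔹̄⁴`, §4, p. 24). [cite: ChenZhu2006, Thm. 1.1 (iii) (p. 3) and §4, p. 24] -/
def IsProjectiveCapPiece (N C : Set M) : Prop :=
  ∃ ι : puncturedRealProjectiveSpace 4 → M, Manifold.IsSmoothEmbedding (𝓡 4) (𝓡 4) ∞ ι ∧
    IsOpen (range ι) ∧
    ι '' {p | (p : Literature.Topology.FourManifolds.RealProjectiveSpace 4) ∉
      Literature.Topology.FourManifolds.RealProjectiveSpace.mk 4 '' polarCapOf 4 (1 / 4)} = C ∧
    ι '' {p | (p : Literature.Topology.FourManifolds.RealProjectiveSpace 4) ∈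
      Literature.Topology.FourManifolds.RealProjectiveSpace.mk 4 '' polarCapOf 4 (1 / 4)} ⊆ N

/-- **A discarded piece**: the open submanifold `C` is also closed (so a union of components of
`M`, compact when `M` is) and is an iterated connected sum of Hamilton's pieces `S⁴`, `ℝℙ⁴`,
`S³ × S¹`, `S³ ×~ S¹` (`Literature.IsConnectedSumOf 4 IsHamiltonPICPiece`) — the components thrown
away at a surgery time: Chen–Zhu 2006, §5, p. 27, "throw away all the compact components lying
in `Ω ∖ Ω_σ` or with positive curvature operator", each "diffeomorphic to `S⁴`, or `ℝℙ⁴`, or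
`S³ × S¹`, or `S³ ×~ S¹`", and the extinct ones, "diffeomorphic to the union of a finite number
of `S⁴`, or `ℝℙ⁴`, or `S³ × S¹`, or `S³ ×~ S¹`, or a connected sum of them" (p. 27); procedures
(2)–(4), pp. 29–30. See the module docstring: this alternative corrects the printed Thm. 1.1
(iii). [cite: ChenZhu2006, §5, p. 27 and pp. 29–30, procedures (2)–(4)] -/
def IsDiscardedPiece (C : Opens M) : Prop :=
  IsClosed (C : Set M) ∧ Literature.Topology.FourManifolds.IsConnectedSumOf 4 IsHamiltonPICPiece C

/-- **The pieces of `M_k ∖ N_k`** (Chen–Zhu 2006, Thm. 1.1 (iii), first half, in the collared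
reading and corrected as in the module docstring): the open set `Nᶜ` has finitely many connected
components, each a collared neck piece `S³ × (0,1)`, a collared ball piece `𝔹⁴`, a collared
projective cap piece `ℝℙ⁴ ∖ 𝔹̄⁴`, or a discarded closed piece.
[cite: ChenZhu2006, Thm. 1.1 (iii) (p. 3)] [cite: ChenZhu2006, §5, p. 27] -/
def PresurgeryPieces (N : Set M) : Prop :=
  (componentsOf Nᶜ).Finite ∧ ∀ C ∈ componentsOf Nᶜ,
    IsNeckPiece N C ∨ IsBallPiece N C ∨ IsProjectiveCapPiece N C ∨
      ∃ C' : Opens M, (C' : Set M) = C ∧ IsDiscardedPiece C'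

/-- **The pieces of `M_{k+1} ∖ N_k`** (Chen–Zhu 2006, Thm. 1.1 (iii), second half: "`M_{k+1} ∖ N_k`
consists of a finite number of disjoint pieces diffeomorphic to `𝔹⁴`", collared reading):
finitely many components, each a collared ball piece. [cite: ChenZhu2006, Thm. 1.1 (iii) (p. 3)] -/
def PostsurgeryPieces (N' : Set M) : Prop :=
  (componentsOf N'ᶜ).Finite ∧ ∀ C ∈ componentsOf N'ᶜ, IsBallPiece N' C

variable (M) in
/-- **`M` is a finite union of pieces** (Chen–Zhu 2006, Thm. 1.1 (iv): "`M_m` is diffeomorphic to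
the disjoint union of a finite number of `S⁴`, or `ℝℙ⁴`, or `S³ × S¹`, or `S³ ×~ S¹`, or
`ℝℙ⁴ # ℝℙ⁴`"), rendered: `M` has finitely many connected components and the component of every
point is an open submanifold lying in the closure of Hamilton's pieces under connected sums
(weaker than the printed list, each of whose members is such). [cite: ChenZhu2006, Thm. 1.1 (iv) (p. 3)] -/
def IsUnionOfPieces : Prop :=
  (componentsOf (univ : Set M)).Finite ∧ ∀ x : M, ∃ C : Opens M,
    (C : Set M) = connectedComponent x ∧ Literature.Topology.FourManifolds.IsConnectedSumOf 4 IsHamiltonPICPiece C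

/-- **Model ball piece**: in `ℝ⁴`, the unit ball is a collared ball piece relative to its
complement (`ι = id`). [folklore] -/
theorem isBallPiece_ball :
    IsBallPiece (M := 𝔼 4) (Metric.ball (0 : 𝔼 4) 1)ᶜ (Metric.ball (0 : 𝔼 4) 1) :=
  ⟨id, Manifold.IsSmoothEmbedding.id, by simp, image_id _, by simp⟩

/-- **Model projective cap piece**: in `ℝℙ⁴ ∖ 𝔹̄⁴` itself, the complement of the (image of the)
cap of height `1/4` is a collared projective cap piece relative to that image (`ι = id`).
[folklore] -/
theorem isProjectiveCapPiece_self :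
    IsProjectiveCapPiece (M := puncturedRealProjectiveSpace 4)
      {p | (p : Literature.Topology.FourManifolds.RealProjectiveSpace 4) ∈ Literature.Topology.FourManifolds.RealProjectiveSpace.mk 4 '' polarCapOf 4 (1 / 4)}
      {p | (p : Literature.Topology.FourManifolds.RealProjectiveSpace 4) ∉
        Literature.Topology.FourManifolds.RealProjectiveSpace.mk 4 '' polarCapOf 4 (1 / 4)} :=
  ⟨id, Manifold.IsSmoothEmbedding.id, by simp, image_id _, by simp⟩

end Pieces

/-! ### One surgery, and resolutions by finitely many surgeries -/

section Surgery

/-- **`(M', g₀')` is obtained from the flow `g` on `M × [0, T)` by one surgery at time `T`**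
(Chen–Zhu 2006, Thm. 1.1 (i)–(iii) between consecutive stages, Def. 5.1): there are an open
`U ⊆ M`, a compact regular domain `N ⊆ U`, a Riemannian metric `ḡ` on `M` by which `g` extends
smoothly to `t = T` over `U` (`ExtendsSmoothlyTo`: (i), localised), and a compact regular domain
`N' ⊆ M'` such that `(N, ḡ)` and `(N', g₀')` are isometric domains ((ii), `AreIsometricDomains`),
the components of `M ∖ N` are finitely many collared necks `S³ × (0,1)`, balls, projective caps or
discarded closed pieces, and the components of `M' ∖ N'` are finitely many collared balls ((iii),
collared reading, corrected as in the module docstring). [cite: ChenZhu2006, Thm. 1.1 (i)–(iii) (p. 3) and Def. 5.1 (p. 26)] -/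
def IsSurgeryStep {M : Type} [TopologicalSpace M] [ChartedSpace (𝔼 4) M] [IsManifold (𝓡 4) ∞ M]
    {M' : Type} [TopologicalSpace M'] [ChartedSpace (𝔼 4) M'] [IsManifold (𝓡 4) ∞ M']
    (g : ℝ → Metric₄ M) (T : ℝ) (g₀' : Metric₄ M') : Prop :=
  ∃ (U N : Set M) (gbar : Metric₄ M) (N' : Set M'),
    IsOpen U ∧ N ⊆ U ∧ gbar.IsRiemannian ∧ ExtendsSmoothlyTo g T gbar U ∧
    IsCompactRegularDomain (𝓡 4) N ∧ IsCompactRegularDomain (𝓡 4) N' ∧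
    AreIsometricDomains gbar g₀' N N' ∧ PresurgeryPieces N ∧ PostsurgeryPieces N'

/-- In a compact manifold, `univ` is a compact regular domain (defining function `-1`, no
boundary). [folklore] -/
theorem isCompactRegularDomain_univ {E : Type*} [NormedAddCommGroup E] [NormedSpace ℝ E]
    {H : Type*} [TopologicalSpace H] (I : ModelWithCorners ℝ E H) (M : Type*) [TopologicalSpace M]
    [ChartedSpace H M] [CompactSpace M] : IsCompactRegularDomain I (univ : Set M) :=
  ⟨isCompact_univ, fun _ ↦ -1, contMDiff_const, by ext; simp, fun x h ↦ by norm_num at h⟩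

/-- The components of the empty set: none. [folklore] -/
@[simp] theorem componentsOf_empty {M : Type*} [TopologicalSpace M] [ChartedSpace (𝔼 4) M] :
    componentsOf (∅ : Set M) = ∅ := by
  simp [componentsOf]

/-- **The trivial surgery** (consistency of the relation): for a Riemannian metric `g` on a closed
`M`, the constant family `t ↦ g` and `(M, g)` itself are related by a surgery step at any time
`T`, with `N = N' = M` (nothing cut, no pieces) and `Φ = id`. [folklore] -/
theorem isSurgeryStep_self {M : Type} [TopologicalSpace M] [CompactSpace M] [ChartedSpace (𝔼 4) M]
    [IsManifold (𝓡 4) ∞ M] (g : Metric₄ M) (hg : g.IsRiemannian) (T : ℝ) :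
    IsSurgeryStep (fun _ ↦ g) T g := by
  refine ⟨univ, univ, g, univ, isOpen_univ, subset_univ _, hg, ?_, isCompactRegularDomain_univ _ _,
    isCompactRegularDomain_univ _ _, areIsometricDomains_refl g univ, ?_, ?_⟩
  · -- the family is constant in time
    have : (fun t : ℝ ↦ if t < T then g else g) = fun _ ↦ g := by funext t; simp
    rw [ExtendsSmoothlyTo, this, isContMDiffFamilyOnSet_univ_iff]
    exact isContMDiffFamilyOn_const g _
  · simp [PresurgeryPieces]
  · simp [PostsurgeryPieces]

/-- **`(M, g₀)` is resolved by a Ricci flow with `m` surgeries** (the structure asserted by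
Chen–Zhu 2006, Thm. 1.1, with `m` surgery times, each stage time-shifted to start at `t = 0`),
by recursion on `m`:
* `m = 0`: the maximal Ricci flow of Riemannian metrics from `g₀` (`IsMaximalRicciFlow`, finite
  time, "goes singular") exists and `M` is already a finite union of pieces (Thm. 1.1 (iv));
* `m + 1`: the maximal flow `g` from `g₀` exists on `[0, T)`, and there is a closed 4-manifold
  `M'` (compact, Hausdorff, second countable, `C^∞` on `ℝ⁴`, possibly disconnected) with a metric
  `g₀'` obtained from `g` by one surgery at time `T` (`IsSurgeryStep`) such that `(M', g₀')` is
  resolved with `m` surgeries.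
[cite: ChenZhu2006, Thm. 1.1 (p. 3) and Def. 5.1 (p. 26)] -/
def ChenZhuResolvableIn : ℕ → ∀ (M : Type) [TopologicalSpace M] [T2Space M]
    [SecondCountableTopology M] [CompactSpace M] [ChartedSpace (𝔼 4) M] [IsManifold (𝓡 4) ∞ M],
    Metric₄ M → Prop
  | 0, M, _, _, _, _, _, _, g₀ =>
      ∃ (g : ℝ → Metric₄ M) (cov : ℝ → Connection₄ M) (T : ℝ),
        IsMaximalRicciFlow g cov T ∧ g 0 = g₀ ∧ IsUnionOfPieces M
  | m + 1, M, _, _, _, _, _, _, g₀ =>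
      ∃ (g : ℝ → Metric₄ M) (cov : ℝ → Connection₄ M) (T : ℝ),
        IsMaximalRicciFlow g cov T ∧ g 0 = g₀ ∧
        ∃ (M' : Type) (_ : TopologicalSpace M') (_ : T2Space M') (_ : SecondCountableTopology M')
          (_ : CompactSpace M') (_ : ChartedSpace (𝔼 4) M') (_ : IsManifold (𝓡 4) ∞ M')
          (g₀' : Metric₄ M'), IsSurgeryStep g T g₀' ∧ ChenZhuResolvableIn m M' g₀'

variable {M : Type} [TopologicalSpace M] [T2Space M] [SecondCountableTopology M] [CompactSpace M]
  [ChartedSpace (𝔼 4) M] [IsManifold (𝓡 4) ∞ M]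

/-- Unfolding the base case. [folklore] -/
theorem chenZhuResolvableIn_zero_iff (g₀ : Metric₄ M) :
    ChenZhuResolvableIn 0 M g₀ ↔ ∃ (g : ℝ → Metric₄ M) (cov : ℝ → Connection₄ M) (T : ℝ),
      IsMaximalRicciFlow g cov T ∧ g 0 = g₀ ∧ IsUnionOfPieces M := Iff.rfl

/-- Unfolding the successor case. [folklore] -/
theorem chenZhuResolvableIn_succ_iff (m : ℕ) (g₀ : Metric₄ M) :
    ChenZhuResolvableIn (m + 1) M g₀ ↔ ∃ (g : ℝ → Metric₄ M) (cov : ℝ → Connection₄ M) (T : ℝ),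
      IsMaximalRicciFlow g cov T ∧ g 0 = g₀ ∧
      ∃ (M' : Type) (_ : TopologicalSpace M') (_ : T2Space M') (_ : SecondCountableTopology M')
        (_ : CompactSpace M') (_ : ChartedSpace (𝔼 4) M') (_ : IsManifold (𝓡 4) ∞ M')
        (g₀' : Metric₄ M'), IsSurgeryStep g T g₀' ∧ ChenZhuResolvableIn m M' g₀' := Iff.rfl

/-- In every case the first stage is the maximal Ricci flow from `g₀` ("`g^{(0)}(t_0) = g_{ij}`,
which go[es] singular"). [cite: ChenZhu2006, Thm. 1.1 (p. 3)] -/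
theorem ChenZhuResolvableIn.exists_isMaximalRicciFlow {m : ℕ} {g₀ : Metric₄ M}
    (h : ChenZhuResolvableIn m M g₀) :
    ∃ (g : ℝ → Metric₄ M) (cov : ℝ → Connection₄ M) (T : ℝ),
      IsMaximalRicciFlow g cov T ∧ g 0 = g₀ := by
  cases m with
  | zero =>
    obtain ⟨g, cov, T, hmax, h0, -⟩ := h
    exact ⟨g, cov, T, hmax, h0⟩
  | succ m =>
    obtain ⟨g, cov, T, hmax, h0, -⟩ := h
    exact ⟨g, cov, T, hmax, h0⟩

/-- The initial metric of a resolvable pair is Riemannian (it is `g 0` of a maximal flow of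
Riemannian metrics). [folklore] -/
theorem ChenZhuResolvableIn.isRiemannian {m : ℕ} {g₀ : Metric₄ M}
    (h : ChenZhuResolvableIn m M g₀) : g₀.IsRiemannian := by
  obtain ⟨g, cov, T, hmax, h0⟩ := h.exists_isMaximalRicciFlow
  rw [← h0]
  exact hmax.isRiemannian 0 hmax.zero_mem

end Surgery

end Literature.Geometry.Riemannian

end
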